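import Literature.MathematicalPhysics.QuantumLattice.FinDimSpectrumSectorGibbsLimit
import Literature.MathematicalPhysics.QuantumLattice.SectorGroundProjContinuity
import Literature.MathematicalPhysics.QuantumLattice.DuhamelTwoPoint
import HarnessLib

/-!
# The entropy price of zero temperature in a sector

Solo programme `solo-HubbardSuperconductivity-blind`, structural Theorem 18, part (a) (the transfer
theorems are in `SoloBlindSectorGibbsTransfer`, the Hubbard corollaries in
`SoloBlindThermalPenaltyEntropy`). Finite-dimensional, for a Hermitian `B` leaving a subspace
("sector") `K ≠ ⊥` invariant, with `P_K` the orthogonal projection, `Z_K(β) = tr (P_K e^{-βB})` and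
the canonical sector Gibbs average `⟨M⟩ = tr (P_K e^{-βB} M) / Z_K`:

* `trace_proj_gibbsWeight_mul_eq_sum` — the eigenbasis form
  `tr (P_K e^{-βB} M) = Σⱼ e^{-βλⱼ} ⟨P_K uⱼ, M P_K uⱼ⟩` (`M` leaving `K` invariant), hence
  `Z_K` is real and `> 0` (`im_trace_sectorGibbs_eq_zero`, `re_trace_sectorGibbs_pos`: the ground
  multiplet carries weight `≥ 1`, `one_le_sum_ground_weights`) and
  `m Z_K ≤ re tr (P_K e^{-βB} M)` whenever `M ≥ m` on `K` (`mul_re_trace_sectorGibbs_le`).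
* `re_trace_sectorGibbs_hamiltonian_le` — **the entropy price**: for `β > 0`,
  `re tr (P_K e^{-βB} B) ≤ (minEnergyOn B K + log (dim K) / β) · Z_K(β)`, i.e.
  `⟨B⟩_β - E₀(B|K) ≤ S(ρ_β)/β ≤ log (dim K) / β` (Gibbs variational principle), proved from the
  finite log-sum inequality `sum_mul_le_sum_mul_log` — no entropy functional is introduced.

Elementary (Bratteli–Robinson II, Prop. 5.3.1 ff.; Tasaki, *Physics and Mathematics of Quantum
Many-Body Systems* (2020), App. A; log-sum inequality: Cover–Thomas Thm 2.7.1). The use — an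
explicit, gap-free temperature scale for the zero-temperature clause of `HubbardSuperconductivity`
(`SoloBlindThermalPenaltyEntropy`) — is the point. [this work]
-/

noncomputable section

namespace Summit.HubbardSuperconductivity.HubbardSuperconductivity.Theorems

open Matrix Filter Topology Literature.MathematicalPhysics.QuantumLattice
  Literature.MathematicalPhysics.QuantumLattice.EigenvalueContinuation
open scoped ComplexOrder

/-! ### A real inequality -/

/-- **Finite log-sum / Gibbs inequality.** For weights `aⱼ ≥ 0` with `Σ aⱼ ≥ 1` and reals `yⱼ`
with `Σ aⱼ e^{yⱼ} ≤ D`: `Σ aⱼ yⱼ ≤ (Σ aⱼ) log D` (termwise `y + 1 ≤ eʸ` at `yⱼ + log (Z/D)`,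
`Z = Σ aⱼ`; i.e. `Σ (aⱼ/Z) yⱼ ≤ log Σ (aⱼ/Z) e^{yⱼ} ≤ log (D/Z) ≤ log D`). [folklore] -/
theorem sum_mul_le_sum_mul_log {ι : Type*} (s : Finset ι) {a y : ι → ℝ} {D : ℝ}
    (ha : ∀ j ∈ s, 0 ≤ a j) (hZ : 1 ≤ ∑ j ∈ s, a j)
    (hD : ∑ j ∈ s, a j * Real.exp (y j) ≤ D) :
    ∑ j ∈ s, a j * y j ≤ (∑ j ∈ s, a j) * Real.log D := by
  set Z := ∑ j ∈ s, a j with hZdef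
  have hZ0 : 0 < Z := by linarith
  obtain ⟨j₀, hj₀, hj₀0⟩ : ∃ j ∈ s, 0 < a j := by
    by_contra h
    have : Z ≤ 0 := Finset.sum_nonpos fun j hj => not_lt.1 fun hlt => h ⟨j, hj, hlt⟩
    linarith
  have hD0 : 0 < D := by
    refine lt_of_lt_of_le (lt_of_lt_of_le (mul_pos hj₀0 (Real.exp_pos (y j₀))) ?_) hD
    exact Finset.single_le_sum (f := fun j => a j * Real.exp (y j))
      (fun i hi => mul_nonneg (ha i hi) (Real.exp_nonneg _)) hj₀
  have hterm : ∀ j ∈ s,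
      a j * y j + (Real.log (Z / D) + 1) * a j ≤ Z / D * (a j * Real.exp (y j)) := by
    intro j hj
    have h1 := Real.add_one_le_exp (y j + Real.log (Z / D))
    rw [Real.exp_add, Real.exp_log (div_pos hZ0 hD0)] at h1
    have h2 := mul_le_mul_of_nonneg_left h1 (ha j hj)
    have e1 : a j * y j + (Real.log (Z / D) + 1) * a j = a j * (y j + Real.log (Z / D) + 1) := by
      ring
    have e2 : Z / D * (a j * Real.exp (y j)) = a j * (Real.exp (y j) * (Z / D)) := by ring
    rw [e1, e2]
    exact h2
  have hsum := Finset.sum_le_sum hterm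
  rw [Finset.sum_add_distrib, ← Finset.mul_sum, ← Finset.mul_sum, ← hZdef] at hsum
  have h2 : Z / D * ∑ j ∈ s, a j * Real.exp (y j) ≤ Z :=
    calc Z / D * ∑ j ∈ s, a j * Real.exp (y j) ≤ Z / D * D :=
          mul_le_mul_of_nonneg_left hD (div_nonneg hZ0.le hD0.le)
      _ = Z := div_mul_cancel₀ Z hD0.ne'
  have hlog : Real.log (Z / D) = Real.log Z - Real.log D := Real.log_div hZ0.ne' hD0.ne'
  have hlogZ : 0 ≤ Z * Real.log Z := mul_nonneg hZ0.le (Real.log_nonneg hZ)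
  rw [hlog] at hsum
  linarith

/-! ### Traces against `P_K · U diag(d) U⋆` -/

section Abstract

variable {n : Type*} [Fintype n] [DecidableEq n]

/- **Sector projector** `P_K`: the orthogonal projection (`projMatrix`) onto `K ≤ ℂⁿ` transported to
`EuclideanSpace ℂ n` — a local notation only (the argument shape of the Literature lemmas
`trace_projMatrix_map_eq_finrank`, `projMatrix_map_mulVec_mem`, …), so that no new definition
enters the tree; every statement below is about this explicit matrix. -/
set_option quotPrecheck false in
local notation "𝐏[" K "]" => projMatrix (Submodule.map
    ((WithLp.linearEquiv 2 ℂ (n → ℂ)).symm : (n → ℂ) →ₗ[ℂ] EuclideanSpace ℂ n) K)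

omit [DecidableEq n] in
/-- `tr (X · U diag(d) U⋆ · M) = Σⱼ dⱼ ⟨uⱼ, (M X) uⱼ⟩` over the columns `uⱼ` of ANY square matrix
`U` (cyclicity of the trace). [folklore] -/
theorem trace_mul_conj_diagonal_mul [DecidableEq n] (X U M : Matrix n n ℂ) (d : n → ℂ) :
    (X * (U * diagonal d * star U) * M).trace =
      ∑ j, d j * (star (fun i => U i j) ⬝ᵥ ((M * X) *ᵥ fun i => U i j)) := by
  have hcyc : (X * (U * diagonal d * star U) * M).trace =
      (diagonal d * (star U * (M * X * U))).trace := by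
    calc (X * (U * diagonal d * star U) * M).trace
          = ((X * U) * (diagonal d * (star U * M))).trace := by simp only [Matrix.mul_assoc]
      _ = ((diagonal d * (star U * M)) * (X * U)).trace := Matrix.trace_mul_comm _ _
      _ = (diagonal d * (star U * (M * X * U))).trace := by simp only [Matrix.mul_assoc]
  rw [hcyc]
  simp only [Matrix.trace, Matrix.diag_apply, diagonal_mul]
  refine Finset.sum_congr rfl fun j _ => ?_
  congr 1

/-- **Sector trace formula.** For a subspace `K`, any square matrix `U` with columns `uⱼ`, any
diagonal `d` and any `M` leaving `K` invariant:
`tr (P_K · U diag(d) U⋆ · M) = Σⱼ dⱼ ⟨P_K uⱼ, M P_K uⱼ⟩` (`P_K` Hermitian, onto `K`, fixing `K`).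
[folklore] -/
theorem trace_proj_conj_diagonal_mul (K : Submodule ℂ (n → ℂ)) (U : Matrix n n ℂ) (d : n → ℂ)
    {M : Matrix n n ℂ} (hMK : ∀ v ∈ K, M *ᵥ v ∈ K) :
    (𝐏[K] * (U * diagonal d * star U) * M).trace =
      ∑ j, d j * (star (𝐏[K] *ᵥ fun i => U i j) ⬝ᵥ (M *ᵥ (𝐏[K] *ᵥ fun i => U i j))) := by
  rw [trace_mul_conj_diagonal_mul]
  refine Finset.sum_congr rfl fun j _ => ?_
  congr 1
  have hPh : (𝐏[K]).IsHermitian := projMatrix_isHermitian _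
  have hx : M *ᵥ (𝐏[K] *ᵥ fun i => U i j) ∈ K := hMK _ (projMatrix_map_mulVec_mem K _)
  calc star (fun i => U i j) ⬝ᵥ ((M * 𝐏[K]) *ᵥ fun i => U i j)
      = star (fun i => U i j) ⬝ᵥ (𝐏[K] *ᵥ (M *ᵥ (𝐏[K] *ᵥ fun i => U i j))) := by
        rw [← mulVec_mulVec, projMatrix_map_mulVec_of_mem K hx]
    _ = star (𝐏[K] *ᵥ fun i => U i j) ⬝ᵥ (M *ᵥ (𝐏[K] *ᵥ fun i => U i j)) := by
        rw [star_mulVec, hPh.eq, ← dotProduct_mulVec]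

/-! ### The sector Gibbs state in the eigenbasis -/

/-- **`tr (P_K e^{-βB} M) = Σⱼ e^{-βλⱼ} ⟨P_K uⱼ, M P_K uⱼ⟩`** in the eigenbasis `uⱼ` (`λⱼ`) of a
Hermitian `B`, for `M` leaving `K` invariant. [folklore] -/
theorem trace_proj_gibbsWeight_mul_eq_sum {B : Matrix n n ℂ} (hB : B.IsHermitian)
    (K : Submodule ℂ (n → ℂ)) (β : ℝ) {M : Matrix n n ℂ} (hMK : ∀ v ∈ K, M *ᵥ v ∈ K) :
    (𝐏[K] * gibbsWeight β B * M).trace =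
      ∑ j, (Real.exp (-(β * hB.eigenvalues j)) : ℂ) *
        (star (𝐏[K] *ᵥ fun i => (hB.eigenvectorUnitary : Matrix n n ℂ) i j) ⬝ᵥ
          (M *ᵥ (𝐏[K] *ᵥ fun i => (hB.eigenvectorUnitary : Matrix n n ℂ) i j))) := by
  rw [hB.gibbsWeight_eq β]
  exact trace_proj_conj_diagonal_mul K (hB.eigenvectorUnitary : Matrix n n ℂ)
    (fun i => (Real.exp (-(β * hB.eigenvalues i)) : ℂ)) hMK

/-- **`Z_K(β) = Σⱼ e^{-βλⱼ} ‖P_K uⱼ‖²`.** [folklore] -/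
theorem trace_proj_gibbsWeight_eq_sum {B : Matrix n n ℂ} (hB : B.IsHermitian)
    (K : Submodule ℂ (n → ℂ)) (β : ℝ) :
    (𝐏[K] * gibbsWeight β B).trace =
      ∑ j, (Real.exp (-(β * hB.eigenvalues j)) : ℂ) *
        (star (𝐏[K] *ᵥ fun i => (hB.eigenvectorUnitary : Matrix n n ℂ) i j) ⬝ᵥ
          (𝐏[K] *ᵥ fun i => (hB.eigenvectorUnitary : Matrix n n ℂ) i j)) := by
  have h := trace_proj_gibbsWeight_mul_eq_sum hB K β (M := 1) (fun v hv => by rwa [one_mulVec])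
  simpa only [Matrix.mul_one, one_mulVec] using h

/-- **`Σⱼ ‖P_K uⱼ‖² = dim K`** over an eigenbasis (`β = 0`: `tr P_K = dim K`). [folklore] -/
theorem sum_normSq_proj_eigenvectors_eq_finrank {B : Matrix n n ℂ} (hB : B.IsHermitian)
    (K : Submodule ℂ (n → ℂ)) :
    ∑ j, star (𝐏[K] *ᵥ fun i => (hB.eigenvectorUnitary : Matrix n n ℂ) i j) ⬝ᵥ
        (𝐏[K] *ᵥ fun i => (hB.eigenvectorUnitary : Matrix n n ℂ) i j) =
      (Module.finrank ℂ K : ℂ) := by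
  have h := trace_proj_gibbsWeight_eq_sum hB K 0
  simp only [gibbsWeight_zero, Matrix.mul_one, zero_mul, neg_zero, Real.exp_zero,
    Complex.ofReal_one, one_mul] at h
  rw [← h, trace_projMatrix_map_eq_finrank]

/-- **The ground multiplet carries weight `≥ 1`:** `Σ_{λⱼ = e₀} ‖P_K uⱼ‖² = dim (K ⊓ ker(B - e₀))
≥ 1`, `e₀ = minEnergyOn B K`, for an invariant `K ≠ ⊥` (`P_K · U 𝟙[λ = e₀] U⋆ = P_{E₀}`,
`projMatrix_map_mul_spectralIndicator_eq`). [folklore] -/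
theorem one_le_sum_ground_weights {B : Matrix n n ℂ} (hB : B.IsHermitian)
    (K : Submodule ℂ (n → ℂ)) (hinv : ∀ v ∈ K, B *ᵥ v ∈ K) (hK : K ≠ ⊥) :
    1 ≤ ∑ j, (if hB.eigenvalues j = B.minEnergyOn K then
      (star (𝐏[K] *ᵥ fun i => (hB.eigenvectorUnitary : Matrix n n ℂ) i j) ⬝ᵥ
        (𝐏[K] *ᵥ fun i => (hB.eigenvectorUnitary : Matrix n n ℂ) i j)).re else 0) := by
  have h := trace_proj_conj_diagonal_mul K (hB.eigenvectorUnitary : Matrix n n ℂ)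
    (fun i => if hB.eigenvalues i = B.minEnergyOn K then (1 : ℂ) else 0) (M := 1)
    (fun v hv => by rwa [one_mulVec])
  rw [Matrix.mul_one, projMatrix_map_mul_spectralIndicator_eq hB K hinv,
    trace_projMatrix_map_eq_finrank] at h
  have hE₀ := inf_eigenspace_minEnergyOn_ne_bot hB K hinv hK
  have h1 : (1 : ℝ) ≤ (Module.finrank ℂ ↥(K ⊓ Module.End.eigenspace (Matrix.toLin' B)
      ((B.minEnergyOn K : ℝ) : ℂ)) : ℝ) := by
    exact_mod_cast Submodule.one_le_finrank_iff.mpr hE₀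
  have h2 := congrArg Complex.re h
  rw [Complex.natCast_re, Complex.re_sum] at h2
  rw [h2] at h1
  refine h1.trans (le_of_eq (Finset.sum_congr rfl fun j _ => ?_))
  split_ifs with hj
  · rw [one_mul, one_mulVec]
  · rw [zero_mul, Complex.zero_re]

/-- **`Z_K(β)` is real …** [folklore] -/
theorem im_trace_sectorGibbs_eq_zero {B : Matrix n n ℂ} (hB : B.IsHermitian)
    (K : Submodule ℂ (n → ℂ)) (β : ℝ) : (𝐏[K] * gibbsWeight β B).trace.im = 0 := by
  rw [trace_proj_gibbsWeight_eq_sum hB K β, Complex.im_sum]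
  refine Finset.sum_eq_zero fun j _ => ?_
  rw [Complex.im_ofReal_mul, ← (Complex.nonneg_iff.1 (dotProduct_star_self_nonneg _)).2, mul_zero]

/-- **… and positive** (the ground multiplet contributes `≥ e^{-βe₀}`), for an invariant `K ≠ ⊥`.
[folklore] -/
theorem re_trace_sectorGibbs_pos {B : Matrix n n ℂ} (hB : B.IsHermitian)
    (K : Submodule ℂ (n → ℂ)) (hinv : ∀ v ∈ K, B *ᵥ v ∈ K) (hK : K ≠ ⊥) (β : ℝ) :
    0 < (𝐏[K] * gibbsWeight β B).trace.re := by
  have hG := one_le_sum_ground_weights hB K hinv hK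
  rw [trace_proj_gibbsWeight_eq_sum hB K β, Complex.re_sum]
  have hexp : 0 < Real.exp (-(β * B.minEnergyOn K)) := Real.exp_pos _
  refine lt_of_lt_of_le (mul_pos hexp (lt_of_lt_of_le one_pos hG)) ?_
  rw [Finset.mul_sum]
  refine Finset.sum_le_sum fun j _ => ?_
  rw [Complex.re_ofReal_mul]
  split_ifs with hj
  · rw [hj]
  · rw [mul_zero]
    exact mul_nonneg (Real.exp_nonneg _) (re_star_dotProduct_self_nonneg _)

/-- The sector Gibbs average of `M` has real part `re tr (P_K e^{-βB} M) / Z_K`. [folklore] -/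
theorem re_sectorGibbs_div_eq {B : Matrix n n ℂ} (hB : B.IsHermitian)
    (K : Submodule ℂ (n → ℂ)) (β : ℝ) (M : Matrix n n ℂ) :
    ((𝐏[K] * gibbsWeight β B * M).trace / (𝐏[K] * gibbsWeight β B).trace).re =
      (𝐏[K] * gibbsWeight β B * M).trace.re / (𝐏[K] * gibbsWeight β B).trace.re := by
  have hZ : (𝐏[K] * gibbsWeight β B).trace =
      (((𝐏[K] * gibbsWeight β B).trace.re : ℝ) : ℂ) :=
    Complex.ext (by rw [Complex.ofReal_re]) (by rw [Complex.ofReal_im, im_trace_sectorGibbs_eq_zero hB K β])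
  rw [hZ, Complex.div_ofReal_re, Complex.ofReal_re]

/-- **Every-state lower bound ⇒ thermal lower bound:** if `m ‖φ‖² ≤ re ⟨φ, M φ⟩` on `K` and `M`
leaves `K` invariant, then `m · Z_K(β) ≤ re tr (P_K e^{-βB} M)`. [folklore] -/
theorem mul_re_trace_sectorGibbs_le {B : Matrix n n ℂ} (hB : B.IsHermitian)
    (K : Submodule ℂ (n → ℂ)) (β : ℝ) {M : Matrix n n ℂ} (hMK : ∀ v ∈ K, M *ᵥ v ∈ K) {m : ℝ}
    (hm : ∀ φ ∈ K, m * (star φ ⬝ᵥ φ).re ≤ (star φ ⬝ᵥ M *ᵥ φ).re) :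
    m * (𝐏[K] * gibbsWeight β B).trace.re ≤ (𝐏[K] * gibbsWeight β B * M).trace.re := by
  rw [trace_proj_gibbsWeight_eq_sum hB K β, trace_proj_gibbsWeight_mul_eq_sum hB K β hMK,
    Complex.re_sum, Complex.re_sum, Finset.mul_sum]
  refine Finset.sum_le_sum fun j _ => ?_
  rw [Complex.re_ofReal_mul, Complex.re_ofReal_mul, mul_left_comm]
  exact mul_le_mul_of_nonneg_left (hm _ (projMatrix_map_mulVec_mem K _)) (Real.exp_nonneg _)

/-! ### The entropy price of zero temperature -/

/-- **Gibbs energy ≤ sector ground energy + log (dim K) / β.** For a Hermitian `B`, an invariant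
sector `K ≠ ⊥` and `β > 0`:
`re tr (P_K e^{-βB} B) ≤ (minEnergyOn B K + log (dim K) / β) · Z_K(β)` — the energy of the
canonical sector Gibbs state exceeds the sector ground energy by at most its entropy over `β`,
and the entropy of a state on `K` is at most `log dim K` (in the eigenbasis: weights
`aⱼ = e^{-β(λⱼ-e₀)} ‖P_K uⱼ‖²`, `Σ_{λⱼ=e₀} ≥ 1`, `Σⱼ aⱼ e^{β(λⱼ-e₀)} = dim K`, and
`sum_mul_le_sum_mul_log`). Bratteli–Robinson II §5.3.1 (Gibbs variational principle). [folklore] -/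
theorem re_trace_sectorGibbs_hamiltonian_le {B : Matrix n n ℂ} (hB : B.IsHermitian)
    (K : Submodule ℂ (n → ℂ)) (hinv : ∀ v ∈ K, B *ᵥ v ∈ K) (hK : K ≠ ⊥) {β : ℝ} (hβ : 0 < β) :
    (𝐏[K] * gibbsWeight β B * B).trace.re ≤
      (B.minEnergyOn K + Real.log (Module.finrank ℂ K) / β) *
        (𝐏[K] * gibbsWeight β B).trace.re := by
  set U : Matrix n n ℂ := (hB.eigenvectorUnitary : Matrix n n ℂ) with hU
  set e₀ : ℝ := B.minEnergyOn K with he₀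
  set w : n → ℝ := fun j => (star (𝐏[K] *ᵥ fun i => U i j) ⬝ᵥ (𝐏[K] *ᵥ fun i => U i j)).re
    with hw
  have hw0 : ∀ j, 0 ≤ w j := fun j => re_star_dotProduct_self_nonneg _
  -- the projected columns are eigenvectors
  have hcol : ∀ j, B *ᵥ (𝐏[K] *ᵥ fun i => U i j) =
      ((hB.eigenvalues j : ℝ) : ℂ) • (𝐏[K] *ᵥ fun i => U i j) := by
    intro j
    have h : (fun i => U i j) = ⇑(hB.eigenvectorBasis j) :=
      funext fun i => IsHermitian.eigenvectorUnitary_apply hB i j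
    have h2 : B *ᵥ (fun i => U i j) = ((hB.eigenvalues j : ℝ) : ℂ) • (fun i => U i j) := by
      rw [h, hB.mulVec_eigenvectorBasis j, RCLike.real_smul_eq_coe_smul (K := ℂ)]
      rfl
    rw [mulVec_mulVec, ← projMatrix_map_commute_of_invariant hB K hinv, ← mulVec_mulVec, h2,
      mulVec_smul]
  -- the sums
  have hTB : (𝐏[K] * gibbsWeight β B * B).trace.re =
      ∑ j, Real.exp (-(β * hB.eigenvalues j)) * (hB.eigenvalues j * w j) := by
    rw [trace_proj_gibbsWeight_mul_eq_sum hB K β hinv, Complex.re_sum]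
    refine Finset.sum_congr rfl fun j _ => ?_
    rw [hcol j, dotProduct_smul, smul_eq_mul, Complex.re_ofReal_mul, Complex.re_ofReal_mul]
  have hZ : (𝐏[K] * gibbsWeight β B).trace.re =
      ∑ j, Real.exp (-(β * hB.eigenvalues j)) * w j := by
    rw [trace_proj_gibbsWeight_eq_sum hB K β, Complex.re_sum]
    refine Finset.sum_congr rfl fun j _ => ?_
    rw [Complex.re_ofReal_mul]
  have hD : ∑ j, w j = (Module.finrank ℂ K : ℝ) := by
    have h := congrArg Complex.re (sum_normSq_proj_eigenvectors_eq_finrank hB K)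
    rwa [Complex.re_sum, Complex.natCast_re] at h
  have hG : 1 ≤ ∑ j, (if hB.eigenvalues j = e₀ then w j else 0) :=
    one_le_sum_ground_weights hB K hinv hK
  -- shifted Boltzmann weights
  set a : n → ℝ := fun j => Real.exp (-(β * (hB.eigenvalues j - e₀))) * w j with ha
  have ha0 : ∀ j, 0 ≤ a j := fun j => mul_nonneg (Real.exp_nonneg _) (hw0 j)
  have hZ1 : 1 ≤ ∑ j, a j := by
    refine hG.trans (Finset.sum_le_sum fun j _ => ?_)
    split_ifs with hj
    · simp only [ha, hj, sub_self, mul_zero, neg_zero, Real.exp_zero, one_mul]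
      exact le_rfl
    · exact ha0 j
  have haw : ∀ j, a j * Real.exp (β * (hB.eigenvalues j - e₀)) = w j := by
    intro j
    simp only [ha]
    rw [mul_right_comm, ← Real.exp_add, neg_add_cancel, Real.exp_zero, one_mul]
  have hS := sum_mul_le_sum_mul_log Finset.univ (a := a)
    (y := fun j => β * (hB.eigenvalues j - e₀)) (D := (Module.finrank ℂ K : ℝ))
    (fun j _ => ha0 j) hZ1 (by rw [← hD]; exact le_of_eq (Finset.sum_congr rfl fun j _ => haw j))
  have hfac : ∀ j, Real.exp (-(β * hB.eigenvalues j)) =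
      Real.exp (-(β * e₀)) * Real.exp (-(β * (hB.eigenvalues j - e₀))) := by
    intro j
    rw [← Real.exp_add]
    congr 1
    ring
  have hTB' : (𝐏[K] * gibbsWeight β B * B).trace.re =
      Real.exp (-(β * e₀)) * ∑ j, a j * hB.eigenvalues j := by
    rw [hTB, Finset.mul_sum]
    refine Finset.sum_congr rfl fun j _ => ?_
    rw [hfac j]
    simp only [ha]
    ring
  have hZ' : (𝐏[K] * gibbsWeight β B).trace.re = Real.exp (-(β * e₀)) * ∑ j, a j := by
    rw [hZ, Finset.mul_sum]
    refine Finset.sum_congr rfl fun j _ => ?_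
    rw [hfac j]
    simp only [ha]
    ring
  have hlin : ∑ j, a j * (β * (hB.eigenvalues j - e₀)) =
      β * ∑ j, a j * hB.eigenvalues j - β * e₀ * ∑ j, a j := by
    rw [Finset.mul_sum, Finset.mul_sum, ← Finset.sum_sub_distrib]
    refine Finset.sum_congr rfl fun j _ => ?_
    ring
  rw [hlin] at hS
  have hβ0 : β ≠ 0 := hβ.ne'
  have key : ∑ j, a j * hB.eigenvalues j ≤
      (e₀ + Real.log (Module.finrank ℂ K) / β) * ∑ j, a j := by
    refine le_of_mul_le_mul_left ?_ hβ
    have : β * ((e₀ + Real.log (Module.finrank ℂ K) / β) * ∑ j, a j) =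
        β * e₀ * ∑ j, a j + (∑ j, a j) * Real.log (Module.finrank ℂ K) := by
      field_simp
    rw [this]
    linarith
  rw [hTB', hZ']
  calc Real.exp (-(β * e₀)) * ∑ j, a j * hB.eigenvalues j
      ≤ Real.exp (-(β * e₀)) * ((e₀ + Real.log (Module.finrank ℂ K) / β) * ∑ j, a j) :=
        mul_le_mul_of_nonneg_left key (Real.exp_nonneg _)
    _ = (e₀ + Real.log (Module.finrank ℂ K) / β) * (Real.exp (-(β * e₀)) * ∑ j, a j) := by ring

end Abstract

end Summit.HubbardSuperconductivity.HubbardSuperconductivity.Theorems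

end
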